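import Mathlib
import HarnessLib

/-!
# Convex series closed sets, the open mapping theorem for cs-closed sets, core versus interior,
# and the Lipschitz property of lsc convex functions (Borwein–Zhu 2005, §4.1.2–§4.1.3)

Literature anchor — J. M. Borwein and Q. J. Zhu, *Techniques of Variational Analysis*, CMS Books
in Mathematics, Springer (2005) [bib key `BorweinZhu2005`], Chapter 4 "Variational Techniques in
Convex Analysis", §4.1 "Convex Functions and Sets": §4.1.2 "Local Lipschitz Property of Convex
Functions" (p. 112) and §4.1.3 "Convex Series Closed Sets" (pp. 113–115), with Exercises from
§4.1.4 (pp. 115–117).  Book index: Lipschitz property 112, convex series closed / compact 113,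
core 114, open mapping theorem 114.

Formalised verbatim (real normed space `X`; completeness is assumed exactly where the printed
proof invokes the Baire category theorem or the completeness of `X`):

* Proposition 4.1.1 and Proposition 4.1.2 (p. 112): a convex function locally bounded above is
  locally bounded, and a convex function with `|f| ≤ M` on `B_{2r}(x̄)` is `2M/r`-Lipschitz on
  `B_r(x̄)` — these are Mathlib's `ConvexOn.isBoundedUnder_abs` and
  `ConvexOn.lipschitzOnWith_of_abs_le`; we restate them in the book's form
  (`isBoundedUnder_abs_of_isBoundedUnder`, `lipschitzOnWith_of_abs_le_two_mul`).
* Theorem 4.1.3 (Lipschitz property of convex functions, pp. 112–113): on a Banach space a lsc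
  convex function is locally Lipschitz on `int (dom f)` (`locallyLipschitzOn_interior_of_lsc`,
  with the continuity corollary); the printed Baire-category proof is followed.
* Definition 4.1.4 (p. 113): convex series closed (`IsCSClosed`) and convex series compact
  (`IsCSCompact`) sets; a cs-closed set is convex (`IsCSClosed.convex`).
* Lemma 4.1.5 (p. 113), the closed-convex and open-convex cases (the open case with the printed
  Hahn–Banach separation proof): `isCSClosed_of_isClosed`, `isCSClosed_of_isOpen`.
* Lemma 4.1.6 (pp. 113–114; proof = Exercise 4.1.13): a continuous linear image of a cs-compact set is
  cs-closed (`IsCSCompact.isCSClosed_image`).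
* Theorem 4.1.7 (open mapping theorem for cs-closed sets, p. 114): `int S = int S̄`
  (`IsCSClosed.interior_eq_interior_closure`), through the printed dyadic series construction
  `u = Σ sᵢ/2ⁱ` (`IsCSClosed.closedBall_subset`).
* The core of a set (p. 114, `algCore`, with the book's formula `⋃_{λ>0} λ(S − s) = X` as
  `mem_algCore_iff_iUnion_eq_univ`), `int S ⊆ core S` (Exercise 4.1.17,
  `interior_subset_algCore`), the example of Exercise 4.1.18 showing the inclusion can be proper
  (`coreVsInteriorSet`, `zero_mem_algCore_coreVsInteriorSet`,
  `zero_notMem_interior_coreVsInteriorSet`), and Exercise 4.1.7 (`int C = core C` for cs-closed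
  `C` in a Banach space, `IsCSClosed.interior_eq_algCore`).
* Theorem 4.1.8 (pp. 114–115): for a lsc convex function on a Banach space,
  `core (dom f) = int (dom f)` (`algCore_eq_interior_of_lsc`).
* Exercise 4.1.14 (cs-compact iff cs-closed and bounded, in a Banach space; the open and closed
  balls are cs-compact): `IsCSCompact.isCSClosed`, `IsCSCompact.isBounded`,
  `IsCSClosed.isCSCompact_of_isBounded`, `isCSCompact_iff`, `isCSCompact_closedBall`,
  `isCSCompact_ball`; Exercise 4.1.16 (translates and positive dilates of cs-closed sets are
  cs-closed): `IsCSClosed.vadd`, `IsCSClosed.smul`, `IsCSClosed.sub_div`.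

Conventions / declared deviations.
* Series are taken in the book's (sequential) sense: `Σ_{i=1}^∞ λᵢ xᵢ = x̄` is rendered as
  convergence of the partial sums `∑_{i<n} λᵢ • xᵢ → x̄` (indices from `0`), and `Σ λᵢ = 1` as
  `∑_{i<n} λᵢ → 1`; for nonnegative `λᵢ` the latter is Mathlib's `HasSum λ 1`
  (`hasSum_iff_tendsto_nat_of_nonneg`).
* Extended-valued convex functions `f : X → ℝ ∪ {+∞}` are encoded, as elsewhere in this library,
  by a real function `f` together with its effective domain `D = dom f` and `ConvexOn ℝ D f`;
  lower semicontinuity of the extended-valued function is exactly closedness of all sublevel sets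
  `{x ∈ D | f x ≤ a}`, which is the form in which the printed proofs of Theorems 4.1.3 and 4.1.8
  use it (the sets `Dᵢ`).
* Lemma 4.1.5, Lemma 4.1.6 and Theorem 4.1.7 are stated for real normed spaces: the printed proofs
  do not use completeness (in Theorem 4.1.7 the dyadic series converges by construction).
* The book's `core` ("`s ∈ core S` provided `⋃_{λ>0} λ(S − s) = X`") is named `algCore` to avoid
  the many unrelated `core`s in the library.
* Not formalised: the `G_δ` case of Lemma 4.1.5 (left to Exercise 4.1.12 in the text), the gauge
  and support functions of §4.1.1, Exercises 4.1.1–4.1.6, 4.1.8–4.1.11, 4.1.15, 4.1.19.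
-/

open Set Filter Metric Topology
open scoped Pointwise

namespace Literature.Analysis.Convex.ConvexSeriesClosed

variable {X : Type*} [NormedAddCommGroup X] [NormedSpace ℝ X]

/-! ## §4.1.2 Local Lipschitz property of convex functions -/

/-- **Proposition 4.1.1** (Borwein–Zhu 2005, p. 112).  A convex function which is locally bounded
above at an interior point `x̄` of its domain is locally bounded (i.e. `|f|` is locally bounded
above) at `x̄`; printed proof: `f(y) ≥ 2f(x̄) − M` via `f(x̄) ≤ ½[f(y) + f(2x̄ − y)]`.  This is
Mathlib's `ConvexOn.isBoundedUnder_abs`.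
[cite: BorweinZhu2005, §4.1.2, Prop 4.1.1, p. 112] -/
theorem isBoundedUnder_abs_of_isBoundedUnder {D : Set X} {f : X → ℝ} (hf : ConvexOn ℝ D f)
    {x₀ : X} (hD : D ∈ 𝓝 x₀) (h : (𝓝 x₀).IsBoundedUnder (· ≤ ·) f) :
    (𝓝 x₀).IsBoundedUnder (· ≤ ·) |f| :=
  (hf.isBoundedUnder_abs hD).2 h

/-- **Proposition 4.1.2** (Borwein–Zhu 2005, p. 112).  If `f` is convex on `B_{2r}(x̄)` and
`|f| ≤ M` there, then `f` is Lipschitz on `B_r(x̄)` with rank `2M/r`: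
`|f(y) − f(x)| ≤ (2M/r)‖y − x‖`.  This is Mathlib's `ConvexOn.lipschitzOnWith_of_abs_le`
(with `ε = r`).
[cite: BorweinZhu2005, §4.1.2, Prop 4.1.2, p. 112] -/
theorem lipschitzOnWith_of_abs_le_two_mul {f : X → ℝ} {x₀ : X} {r M : ℝ} (hr : 0 < r)
    (hf : ConvexOn ℝ (ball x₀ (2 * r)) f) (hM : ∀ a ∈ ball x₀ (2 * r), |f a| ≤ M) :
    LipschitzOnWith (2 * M / r).toNNReal f (ball x₀ r) := by
  have h := hf.lipschitzOnWith_of_abs_le hr (fun a ha => hM a (mem_ball.2 ha))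
  have e : 2 * r - r = r := by ring
  rwa [e] at h

/-- **Theorem 4.1.3** (Lipschitz property of convex functions; Borwein–Zhu 2005, pp. 112–113).
Let `X` be a Banach space and `f : X → ℝ ∪ {+∞}` a lsc convex function (domain `D`, sublevel
sets `{x ∈ D | f x ≤ a}` closed).  Then `f` is locally Lipschitz on `int (dom f)`.
Printed proof: the closed sets `Dᵢ = {f ≤ i}` cover `D`, so by the Baire category theorem some
`Dᵢ` contains a ball inside `int D`; hence `f` is bounded above near a point of the open convex
set `int D`, and Propositions 4.1.1–4.1.2 (here through Mathlib's `ConvexOn.continuousOn_tfae`)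
give the local Lipschitz property on all of `int D`.
[cite: BorweinZhu2005, §4.1.2, Thm 4.1.3, pp. 112–113] -/
theorem locallyLipschitzOn_interior_of_lsc [CompleteSpace X] {D : Set X} {f : X → ℝ}
    (hf : ConvexOn ℝ D f) (hlsc : ∀ a : ℝ, IsClosed {x | x ∈ D ∧ f x ≤ a}) :
    LocallyLipschitzOn (interior D) f := by
  rcases (interior D).eq_empty_or_nonempty with hD | hD
  · rw [hD]; exact fun x hx => hx.elim
  have hfi : ConvexOn ℝ (interior D) f := hf.subset interior_subset hf.1.interior
  -- the closed sets `Dᵢ ∪ (int D)ᶜ` cover `X`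
  set G : ℕ → Set X := fun i => {x | x ∈ D ∧ f x ≤ i} ∪ (interior D)ᶜ with hG
  have hGc : ∀ i, IsClosed (G i) := fun i => (hlsc i).union isOpen_interior.isClosed_compl
  have hGU : ⋃ i, G i = univ := by
    refine eq_univ_of_forall fun x => ?_
    by_cases hx : x ∈ interior D
    · obtain ⟨i, hi⟩ := exists_nat_ge (f x)
      exact mem_iUnion.2 ⟨i, Or.inl ⟨interior_subset hx, hi⟩⟩
    · exact mem_iUnion.2 ⟨0, Or.inr hx⟩
  have hdense : Dense (⋃ i, interior (G i)) := dense_iUnion_interior_of_closed hGc hGU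
  obtain ⟨y, hy, hyD⟩ := hdense.exists_mem_open isOpen_interior hD
  obtain ⟨i, hyi⟩ := mem_iUnion.1 hy
  -- `f ≤ i` on the neighbourhood `interior (G i) ∩ interior D` of `y`
  have hbound : (𝓝 y).IsBoundedUnder (· ≤ ·) f := by
    refine Filter.isBoundedUnder_of_eventually_le (a := (i : ℝ)) ?_
    filter_upwards [isOpen_interior.mem_nhds hyi, isOpen_interior.mem_nhds hyD] with z hz hzD
    rcases interior_subset hz with h | h
    · exact h.2
    · exact (h hzD).elim
  have h4 : ∃ x₀ ∈ interior D, (𝓝 x₀).IsBoundedUnder (· ≤ ·) f := ⟨y, hyD, hbound⟩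
  exact ((hfi.continuousOn_tfae isOpen_interior hD).out 3 0).mp h4

/-- Corollary of **Theorem 4.1.3** (Borwein–Zhu 2005, §4.1.2, "lower semicontinuous convex
functions are actually locally Lipschitz [hence continuous] in the interior of their domains"):
continuity on `int (dom f)`.
[cite: BorweinZhu2005, §4.1.2, Thm 4.1.3, pp. 112–113] -/
theorem continuousOn_interior_of_lsc [CompleteSpace X] {D : Set X} {f : X → ℝ}
    (hf : ConvexOn ℝ D f) (hlsc : ∀ a : ℝ, IsClosed {x | x ∈ D ∧ f x ≤ a}) :
    ContinuousOn f (interior D) :=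
  (locallyLipschitzOn_interior_of_lsc hf hlsc).continuousOn

/-! ## §4.1.3 Convex series closed sets -/

/-- **Definition 4.1.4** (convex series closed; Borwein–Zhu 2005, p. 113).  `C` is *cs-closed*
if `x̄ = Σ_{i} λᵢ xᵢ` with `λᵢ ≥ 0`, `Σ λᵢ = 1` and `xᵢ ∈ C` implies `x̄ ∈ C` (series in the
sequential sense: partial sums converge).
[cite: BorweinZhu2005, §4.1.3, Def 4.1.4, p. 113] -/
def IsCSClosed (C : Set X) : Prop :=
  ∀ ⦃w : ℕ → ℝ⦄ ⦃x : ℕ → X⦄ ⦃z : X⦄, (∀ i, 0 ≤ w i) →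
    Tendsto (fun n => ∑ i ∈ Finset.range n, w i) atTop (𝓝 1) → (∀ i, x i ∈ C) →
    Tendsto (fun n => ∑ i ∈ Finset.range n, w i • x i) atTop (𝓝 z) → z ∈ C

/-- **Definition 4.1.4** (convex series compact; Borwein–Zhu 2005, p. 113).  `C` is *cs-compact*
if for all sequences `xᵢ ∈ C` and `λᵢ ≥ 0` with `Σ λᵢ = 1` the series `Σ λᵢ xᵢ` converges to a
point of `C`.
[cite: BorweinZhu2005, §4.1.3, Def 4.1.4, p. 113] -/
def IsCSCompact (C : Set X) : Prop :=
  ∀ ⦃w : ℕ → ℝ⦄ ⦃x : ℕ → X⦄, (∀ i, 0 ≤ w i) →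
    Tendsto (fun n => ∑ i ∈ Finset.range n, w i) atTop (𝓝 1) → (∀ i, x i ∈ C) →
    ∃ z ∈ C, Tendsto (fun n => ∑ i ∈ Finset.range n, w i • x i) atTop (𝓝 z)

/-- If all weights of a convex series vanish, `Σ λᵢ = 1` is impossible; so some weight is
positive. [folklore] -/
private theorem exists_pos_of_tendsto_one {w : ℕ → ℝ} (hw : ∀ i, 0 ≤ w i)
    (hw1 : Tendsto (fun n => ∑ i ∈ Finset.range n, w i) atTop (𝓝 1)) : ∃ i, 0 < w i := by
  by_contra h
  push Not at h
  have h0 : ∀ n, ∑ i ∈ Finset.range n, w i = 0 := fun n =>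
    Finset.sum_eq_zero fun i _ => le_antisymm (h i) (hw i)
  simp_rw [h0] at hw1
  have := tendsto_nhds_unique hw1 tendsto_const_nhds
  norm_num at this

/-- A sequence which is constant from index `2` on is eventually equal to that constant.
[folklore] -/
private theorem eventuallyEq_const_of_forall_add_two {Y : Type*} {g : ℕ → Y} {c : Y}
    (hg : ∀ n, g (n + 2) = c) : g =ᶠ[atTop] fun _ => c := by
  refine eventually_atTop.2 ⟨2, fun n hn => ?_⟩
  obtain ⟨k, rfl⟩ := Nat.exists_eq_add_of_le' hn
  exact hg k

/-- A cs-closed set is convex (take the series with weights `λ, 1 − λ, 0, 0, …`).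
[cite: BorweinZhu2005, §4.1.3, Def 4.1.4 and Lemma 4.1.5, p. 113] -/
theorem IsCSClosed.convex {C : Set X} (hC : IsCSClosed C) : Convex ℝ C := by
  intro a ha b hb wa wb hwa hwb hab
  let w : ℕ → ℝ := fun i => if i = 0 then wa else if i = 1 then wb else 0
  let x : ℕ → X := fun i => if i = 0 then a else b
  have hw : ∀ i, 0 ≤ w i := by
    intro i; dsimp only [w]; split_ifs <;> first | assumption | exact le_rfl
  have hx : ∀ i, x i ∈ C := by
    intro i; dsimp only [x]; split_ifs <;> assumption
  have hs : ∀ n, ∑ i ∈ Finset.range (n + 2), w i = 1 := by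
    intro n
    induction n with
    | zero => simp [Finset.sum_range_succ, w, hab]
    | succ n ih =>
      have h1 : n + 2 ≠ 1 := by omega
      rw [Finset.sum_range_succ, ih]
      simp [w, h1]
  have hv : ∀ n, ∑ i ∈ Finset.range (n + 2), w i • x i = wa • a + wb • b := by
    intro n
    induction n with
    | zero => simp [Finset.sum_range_succ, w, x]
    | succ n ih =>
      have h1 : n + 2 ≠ 1 := by omega
      rw [Finset.sum_range_succ, ih]
      simp [w, h1]
  refine hC hw ?_ hx ?_
  · exact tendsto_const_nhds.congr' (eventuallyEq_const_of_forall_add_two hs).symm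
  · exact tendsto_const_nhds.congr' (eventuallyEq_const_of_forall_add_two hv).symm

/-- **Lemma 4.1.5**, closed case (Borwein–Zhu 2005, p. 113; proof = Exercise 4.1.12): a closed
convex set is cs-closed.  (Proof: the normalised partial sums `Λₙ⁻¹ Σ_{i<n} λᵢ xᵢ` are convex
combinations of points of `C` and converge to `x̄`.)
[cite: BorweinZhu2005, §4.1.3, Lemma 4.1.5, p. 113; Exercise 4.1.12] -/
theorem isCSClosed_of_isClosed {C : Set X} (hCc : IsClosed C) (hCv : Convex ℝ C) :
    IsCSClosed C := by
  intro w x z hw hw1 hx hxs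
  have hΛ : ∀ᶠ n in atTop, (1 / 2 : ℝ) < ∑ i ∈ Finset.range n, w i :=
    hw1.eventually (lt_mem_nhds (by norm_num))
  have hmem : ∀ᶠ n in atTop,
      (∑ i ∈ Finset.range n, w i)⁻¹ • ∑ i ∈ Finset.range n, w i • x i ∈ C := by
    filter_upwards [hΛ] with n hn
    have hpos : 0 < ∑ i ∈ Finset.range n, w i := by linarith
    rw [Finset.smul_sum]
    simp_rw [smul_smul]
    refine hCv.sum_mem (fun i _ => mul_nonneg (inv_nonneg.2 hpos.le) (hw i)) ?_ (fun i _ => hx i)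
    rw [← Finset.mul_sum, inv_mul_cancel₀ hpos.ne']
  have hlim : Tendsto (fun n => (∑ i ∈ Finset.range n, w i)⁻¹ • ∑ i ∈ Finset.range n, w i • x i)
      atTop (𝓝 z) := by
    simpa using (hw1.inv₀ one_ne_zero).smul hxs
  exact hCc.mem_of_tendsto hlim hmem

/-- **Lemma 4.1.5**, open case (Borwein–Zhu 2005, p. 113, with the printed proof): an open
convex set is cs-closed.  If `x̄ = Σ λᵢ xᵢ ∉ C`, the Hahn–Banach separation theorem gives
`x* ∈ X*` with `⟨x*, c⟩ < ⟨x*, x̄⟩` on `C`; summing `λᵢ⟨x*, xᵢ⟩ ≤ λᵢ⟨x*, x̄⟩` (strict for a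
positive weight) contradicts `⟨x*, x̄⟩ = Σ λᵢ ⟨x*, xᵢ⟩`.
[cite: BorweinZhu2005, §4.1.3, Lemma 4.1.5, p. 113] -/
theorem isCSClosed_of_isOpen {C : Set X} (hCo : IsOpen C) (hCv : Convex ℝ C) :
    IsCSClosed C := by
  intro w x z hw hw1 hx hxs
  by_contra hz
  obtain ⟨f, hf⟩ := geometric_hahn_banach_open_point hCv hCo hz
  obtain ⟨i₀, hi₀⟩ := exists_pos_of_tendsto_one hw hw1
  have h1 : Tendsto (fun n => ∑ i ∈ Finset.range n, w i * f (x i)) atTop (𝓝 (f z)) := by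
    have := (f.continuous.tendsto z).comp hxs
    refine this.congr fun n => ?_
    simp [Function.comp, map_sum, map_smul]
  have h2 : Tendsto (fun n => (∑ i ∈ Finset.range n, w i) * f z - w i₀ * (f z - f (x i₀)))
      atTop (𝓝 (1 * f z - w i₀ * (f z - f (x i₀)))) :=
    (hw1.mul_const _).sub_const _
  have h3 : ∀ᶠ n in atTop, ∑ i ∈ Finset.range n, w i * f (x i)
      ≤ (∑ i ∈ Finset.range n, w i) * f z - w i₀ * (f z - f (x i₀)) := by
    filter_upwards [eventually_gt_atTop i₀] with n hn
    have hmem : i₀ ∈ Finset.range n := Finset.mem_range.2 hn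
    have key : ∀ i ∈ (Finset.range n).erase i₀, w i * f (x i) ≤ w i * f z := fun i _ =>
      mul_le_mul_of_nonneg_left (hf _ (hx i)).le (hw i)
    rw [Finset.sum_mul, ← Finset.add_sum_erase _ _ hmem,
      ← Finset.add_sum_erase (Finset.range n) (fun i => w i * f z) hmem]
    have := Finset.sum_le_sum key
    linarith
  have hle := le_of_tendsto_of_tendsto h1 h2 h3
  have hpos : 0 < w i₀ * (f z - f (x i₀)) := mul_pos hi₀ (sub_pos.2 (hf _ (hx i₀)))
  linarith

/-- **Exercise 4.1.14**, first part: a cs-compact set is cs-closed (limits of the series are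
unique).
[cite: BorweinZhu2005, §4.1.4, Exercise 4.1.14] -/
theorem IsCSCompact.isCSClosed {C : Set X} (hC : IsCSCompact C) : IsCSClosed C := by
  intro w x z hw hw1 hx hxs
  obtain ⟨y, hy, hys⟩ := hC hw hw1 hx
  rwa [tendsto_nhds_unique hxs hys]

/-- **Exercise 4.1.14**, second part: a cs-compact set is bounded.  (If `‖xᵢ‖ > 2^{i+1}` then the
terms `2^{-(i+1)} xᵢ` of the convex series do not tend to `0`.)
[cite: BorweinZhu2005, §4.1.4, Exercise 4.1.14] -/
theorem IsCSCompact.isBounded {C : Set X} (hC : IsCSCompact C) : Bornology.IsBounded C := by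
  by_contra hnb
  have hbig : ∀ i : ℕ, ∃ c ∈ C, (2 : ℝ) ^ (i + 1) < ‖c‖ := by
    intro i
    by_contra h
    push Not at h
    exact hnb (isBounded_iff_forall_norm_le.2 ⟨2 ^ (i + 1), h⟩)
  choose x hxC hxn using hbig
  set w : ℕ → ℝ := fun i => (1 / 2) ^ (i + 1) with hw
  have hw0 : ∀ i, 0 ≤ w i := fun i => by positivity
  have hws : ∀ n, ∑ i ∈ Finset.range n, w i = 1 - (1 / 2) ^ n := by
    intro n
    induction n with
    | zero => simp
    | succ n ih => rw [Finset.sum_range_succ, ih, hw, pow_succ]; ring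
  have hw1 : Tendsto (fun n => ∑ i ∈ Finset.range n, w i) atTop (𝓝 1) := by
    simp_rw [hws]
    have h2 := tendsto_pow_atTop_nhds_zero_of_lt_one (r := (1 / 2 : ℝ)) (by norm_num) (by norm_num)
    simpa using (tendsto_const_nhds (x := (1 : ℝ))).sub h2
  obtain ⟨z, -, hxs⟩ := hC hw0 hw1 hxC
  -- consecutive differences of a convergent sequence tend to `0`
  have hdiff : Tendsto (fun n => w n • x n) atTop (𝓝 0) := by
    have := (hxs.comp (tendsto_add_atTop_nat 1)).sub hxs
    rw [sub_self] at this
    refine this.congr fun n => ?_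
    simp [Function.comp, Finset.sum_range_succ]
  have hnorm : ∀ n, 1 ≤ ‖w n • x n‖ := by
    intro n
    rw [norm_smul, hw, norm_pow, norm_div, norm_one, Real.norm_two]
    have h2 : (0 : ℝ) < 2 ^ (n + 1) := by positivity
    calc (1 : ℝ) = (1 / 2) ^ (n + 1) * 2 ^ (n + 1) := by
          rw [← mul_pow]; norm_num
      _ ≤ (1 / 2) ^ (n + 1) * ‖x n‖ := by gcongr; exact (hxn n).le
  have h0 : Tendsto (fun n => ‖w n • x n‖) atTop (𝓝 0) := by
    have := hdiff.norm
    rwa [norm_zero] at this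
  have := h0.eventually (gt_mem_nhds (show (0 : ℝ) < 1 by norm_num))
  obtain ⟨n, hn⟩ := this.exists
  exact absurd (hnorm n) (not_le.2 hn)

/-- **Exercise 4.1.14**, converse (Banach space): a bounded cs-closed set is cs-compact — the
series `Σ λᵢ xᵢ` converges absolutely.
[cite: BorweinZhu2005, §4.1.4, Exercise 4.1.14] -/
theorem IsCSClosed.isCSCompact_of_isBounded [CompleteSpace X] {C : Set X} (hC : IsCSClosed C)
    (hb : Bornology.IsBounded C) : IsCSCompact C := by
  intro w x hw hw1 hx
  obtain ⟨R, hR⟩ := isBounded_iff_forall_norm_le.1 hb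
  have hsum : HasSum w 1 := (hasSum_iff_tendsto_nat_of_nonneg hw 1).2 hw1
  have hS : Summable fun i => w i • x i := by
    refine Summable.of_norm_bounded (g := fun i => w i * R) (hsum.summable.mul_right R) fun i => ?_
    rw [norm_smul, Real.norm_of_nonneg (hw i)]
    exact mul_le_mul_of_nonneg_left (hR _ (hx i)) (hw i)
  obtain ⟨z, hz⟩ := hS
  exact ⟨z, hC hw hw1 hx hz.tendsto_sum_nat, hz.tendsto_sum_nat⟩

/-- **Exercise 4.1.14** (Borwein–Zhu 2005): in a Banach space a set is cs-compact if and only if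
it is cs-closed and bounded.
[cite: BorweinZhu2005, §4.1.4, Exercise 4.1.14] -/
theorem isCSCompact_iff [CompleteSpace X] {C : Set X} :
    IsCSCompact C ↔ IsCSClosed C ∧ Bornology.IsBounded C :=
  ⟨fun h => ⟨h.isCSClosed, h.isBounded⟩, fun h => h.1.isCSCompact_of_isBounded h.2⟩

/-- **Exercise 4.1.14**, in particular: closed balls of a Banach space are cs-compact.
[cite: BorweinZhu2005, §4.1.4, Exercise 4.1.14] -/
theorem isCSCompact_closedBall [CompleteSpace X] (x : X) (r : ℝ) : IsCSCompact (closedBall x r) :=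
  (isCSClosed_of_isClosed isClosed_closedBall (convex_closedBall x r)).isCSCompact_of_isBounded
    isBounded_closedBall

/-- **Exercise 4.1.14**, in particular: open balls of a Banach space are cs-compact.
[cite: BorweinZhu2005, §4.1.4, Exercise 4.1.14] -/
theorem isCSCompact_ball [CompleteSpace X] (x : X) (r : ℝ) : IsCSCompact (ball x r) :=
  (isCSClosed_of_isOpen isOpen_ball (convex_ball x r)).isCSCompact_of_isBounded isBounded_ball

/-- **Lemma 4.1.6** (Borwein–Zhu 2005, pp. 113–114; proof = Exercise 4.1.13).  If `A : X → Y` is a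
continuous linear map and `C ⊆ X` is cs-compact then `A(C)` is cs-closed.
[cite: BorweinZhu2005, §4.1.3, Lemma 4.1.6, pp. 113–114; Exercise 4.1.13] -/
theorem IsCSCompact.isCSClosed_image {Y : Type*} [NormedAddCommGroup Y] [NormedSpace ℝ Y]
    {C : Set X} (hC : IsCSCompact C) (A : X →L[ℝ] Y) : IsCSClosed (A '' C) := by
  intro w y z hw hw1 hy hys
  choose x hxC hxy using hy
  obtain ⟨u, huC, hu⟩ := hC hw hw1 hxC
  have hA : Tendsto (fun n => ∑ i ∈ Finset.range n, w i • y i) atTop (𝓝 (A u)) := by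
    have := (A.continuous.tendsto u).comp hu
    refine this.congr fun n => ?_
    simp [Function.comp, map_sum, map_smul, hxy]
  exact ⟨u, huC, (tendsto_nhds_unique hA hys)⟩

/-- **Exercise 4.1.16** (translation part): a translate of a cs-closed set is cs-closed.
[cite: BorweinZhu2005, §4.1.4, Exercise 4.1.16] -/
theorem IsCSClosed.vadd {S : Set X} (hS : IsCSClosed S) (v : X) : IsCSClosed (v +ᵥ S) := by
  intro w x z hw hw1 hx hxs
  have hx' : ∀ i, x i - v ∈ S := by
    intro i
    obtain ⟨s, hs, hsx⟩ := Set.mem_vadd_set.1 (hx i)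
    rw [← hsx, vadd_eq_add, add_sub_cancel_left]; exact hs
  have hlim : Tendsto (fun n => ∑ i ∈ Finset.range n, w i • (x i - v)) atTop (𝓝 (z - v)) := by
    have := hxs.sub (hw1.smul_const v)
    rw [one_smul] at this
    refine this.congr fun n => ?_
    rw [Finset.sum_smul, ← Finset.sum_sub_distrib]
    exact Finset.sum_congr rfl fun i _ => (smul_sub _ _ _).symm
  have := hS hw hw1 hx' hlim
  exact Set.mem_vadd_set.2 ⟨z - v, this, by rw [vadd_eq_add, add_sub_cancel]⟩

/-- **Exercise 4.1.16** (dilation part): a nonzero dilate of a cs-closed set is cs-closed.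
[cite: BorweinZhu2005, §4.1.4, Exercise 4.1.16] -/
theorem IsCSClosed.smul {S : Set X} (hS : IsCSClosed S) {δ : ℝ} (hδ : δ ≠ 0) :
    IsCSClosed (δ • S) := by
  intro w x z hw hw1 hx hxs
  have hx' : ∀ i, δ⁻¹ • x i ∈ S := by
    intro i
    obtain ⟨s, hs, hsx⟩ := Set.mem_smul_set.1 (hx i)
    rw [← hsx, smul_smul, inv_mul_cancel₀ hδ, one_smul]; exact hs
  have hlim : Tendsto (fun n => ∑ i ∈ Finset.range n, w i • (δ⁻¹ • x i)) atTop (𝓝 (δ⁻¹ • z)) := by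
    have := hxs.const_smul δ⁻¹
    refine this.congr fun n => ?_
    rw [Finset.smul_sum]
    exact Finset.sum_congr rfl fun i _ => smul_comm _ _ _
  have := hS hw hw1 hx' hlim
  exact Set.mem_smul_set.2 ⟨δ⁻¹ • z, this, by rw [smul_smul, mul_inv_cancel₀ hδ, one_smul]⟩

/-- **Exercise 4.1.16** (Borwein–Zhu 2005): if `S` is cs-closed then so is `(S − x̄)/δ` for
`δ > 0`.
[cite: BorweinZhu2005, §4.1.4, Exercise 4.1.16] -/
theorem IsCSClosed.sub_div {S : Set X} (hS : IsCSClosed S) (x₀ : X) {δ : ℝ} (hδ : 0 < δ) :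
    IsCSClosed (δ⁻¹ • (-x₀ +ᵥ S)) :=
  (hS.vadd (-x₀)).smul (inv_ne_zero hδ.ne')

/-- The dyadic approximation step behind Theorem 4.1.7: if `B_r(x) ⊆ S̄` (closed ball, `r > 0`)
and `S` is cs-closed then `B_{r/2}(x) ⊆ S`.  Printed construction: every `u` with
`‖u − x‖ ≤ r/2` is written as a convex series `u = Σ_{i≥1} 2^{-i} sᵢ` with `sᵢ ∈ S`, choosing
`sᵢ` within `r/2` of `x + 2ⁱρ_{i−1}` where `ρᵢ` is the running remainder, `‖ρᵢ‖ ≤ r/2^{i+1}`.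
[cite: BorweinZhu2005, §4.1.3, proof of Thm 4.1.7, (4.1.1)–(4.1.4), p. 114] -/
theorem IsCSClosed.closedBall_subset {S : Set X} (hS : IsCSClosed S) {x : X} {r : ℝ}
    (hr : 0 < r) (h : closedBall x r ⊆ closure S) : closedBall x (r / 2) ⊆ S := by
  intro u hu
  rw [mem_closedBall, dist_eq_norm] at hu
  -- one selection step: weights `(1/2)^(i+1)`, remainders of norm `≤ r / 2^(i+1)`
  have hstep : ∀ (i : ℕ) (ρ : X), ∃ s : X, ‖ρ‖ ≤ r / 2 ^ (i + 1) →
      s ∈ S ∧ ‖ρ - ((1 / 2 : ℝ) ^ (i + 1)) • (s - x)‖ ≤ r / 2 ^ (i + 2) := by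
    intro i ρ
    by_cases hρ : ‖ρ‖ ≤ r / 2 ^ (i + 1)
    · have h2 : (0 : ℝ) < 2 ^ (i + 1) := by positivity
      have hmem : x + (2 : ℝ) ^ (i + 1) • ρ ∈ closure S := by
        refine h ?_
        rw [mem_closedBall, dist_eq_norm, add_sub_cancel_left, norm_smul, norm_pow,
          Real.norm_two]
        calc (2 : ℝ) ^ (i + 1) * ‖ρ‖ ≤ 2 ^ (i + 1) * (r / 2 ^ (i + 1)) := by gcongr
          _ = r := by field_simp
      obtain ⟨s, hs, hds⟩ := Metric.mem_closure_iff.1 hmem (r / 2) (by positivity)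
      refine ⟨s, fun _ => ⟨hs, ?_⟩⟩
      have hhalf : ((1 / 2 : ℝ) ^ (i + 1)) * 2 ^ (i + 1) = 1 := by
        rw [← mul_pow]; norm_num
      have e : ρ - ((1 / 2 : ℝ) ^ (i + 1)) • (s - x)
          = ((1 / 2 : ℝ) ^ (i + 1)) • ((x + (2 : ℝ) ^ (i + 1) • ρ) - s) := by
        simp only [smul_sub, smul_add, smul_smul, hhalf, one_smul]
        abel
      rw [e, norm_smul, norm_pow, norm_div, norm_one, Real.norm_two, ← dist_eq_norm]
      calc (1 / 2 : ℝ) ^ (i + 1) * dist (x + (2 : ℝ) ^ (i + 1) • ρ) s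
          ≤ (1 / 2 : ℝ) ^ (i + 1) * (r / 2) := by gcongr
        _ = r / 2 ^ (i + 2) := by rw [one_div_pow]; field_simp; ring
    · exact ⟨x, fun h' => absurd h' hρ⟩
  choose sel hsel using hstep
  -- the remainders `ρ i` and the chosen points `sel i (ρ i)`
  let ρ : ℕ → X := fun n =>
    Nat.rec (u - x) (fun i ρi => ρi - ((1 / 2 : ℝ) ^ (i + 1)) • (sel i ρi - x)) n
  have hρ0 : ρ 0 = u - x := rfl
  have hρs : ∀ i, ρ (i + 1) = ρ i - ((1 / 2 : ℝ) ^ (i + 1)) • (sel i (ρ i) - x) := fun i => rfl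
  have hρn : ∀ i, ‖ρ i‖ ≤ r / 2 ^ (i + 1) := by
    intro i
    induction i with
    | zero => rw [hρ0, zero_add, pow_one]; exact hu
    | succ i ih => rw [hρs]; exact (hsel i (ρ i) ih).2
  have hmemS : ∀ i, sel i (ρ i) ∈ S := fun i => (hsel i (ρ i) (hρn i)).1
  have htel : ∀ n, ∑ i ∈ Finset.range n, ((1 / 2 : ℝ) ^ (i + 1)) • (sel i (ρ i) - x)
      = ρ 0 - ρ n := by
    intro n
    induction n with
    | zero => simp
    | succ n ih => rw [Finset.sum_range_succ, ih, hρs]; abel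
  have hhalf := tendsto_pow_atTop_nhds_zero_of_lt_one (r := (1 / 2 : ℝ)) (by norm_num)
    (by norm_num)
  have hρlim : Tendsto ρ atTop (𝓝 0) := by
    refine squeeze_zero_norm (fun n => hρn n) ?_
    have : Tendsto (fun n : ℕ => r / 2 * (1 / 2 : ℝ) ^ n) atTop (𝓝 (r / 2 * 0)) :=
      hhalf.const_mul (r / 2)
    rw [mul_zero] at this
    refine this.congr fun n => ?_
    rw [one_div_pow, pow_succ]
    field_simp
  have hws : ∀ n, ∑ i ∈ Finset.range n, (1 / 2 : ℝ) ^ (i + 1) = 1 - (1 / 2) ^ n := by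
    intro n
    induction n with
    | zero => simp
    | succ n ih => rw [Finset.sum_range_succ, ih, pow_succ]; ring
  have hw1 : Tendsto (fun n => ∑ i ∈ Finset.range n, (1 / 2 : ℝ) ^ (i + 1)) atTop (𝓝 1) := by
    simp_rw [hws]
    simpa using (tendsto_const_nhds (x := (1 : ℝ))).sub hhalf
  have hser : Tendsto (fun n => ∑ i ∈ Finset.range n, ((1 / 2 : ℝ) ^ (i + 1)) • sel i (ρ i))
      atTop (𝓝 u) := by
    have heq : ∀ n, ∑ i ∈ Finset.range n, ((1 / 2 : ℝ) ^ (i + 1)) • sel i (ρ i)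
        = (ρ 0 - ρ n) + (∑ i ∈ Finset.range n, (1 / 2 : ℝ) ^ (i + 1)) • x := by
      intro n
      rw [← htel, Finset.sum_smul, ← Finset.sum_add_distrib]
      refine Finset.sum_congr rfl fun i _ => ?_
      rw [smul_sub, sub_add_cancel]
    simp_rw [heq]
    have := ((tendsto_const_nhds (x := ρ 0)).sub hρlim).add (hw1.smul_const x)
    simpa [hρ0] using this
  exact hS (fun i => by positivity) hw1 hmemS hser

/-- **Theorem 4.1.7** (open mapping theorem for cs-closed sets; Borwein–Zhu 2005, p. 114), the
inclusion `int S̄ ⊆ S` for a cs-closed `S`.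
[cite: BorweinZhu2005, §4.1.3, Thm 4.1.7, p. 114] -/
theorem IsCSClosed.interior_closure_subset {S : Set X} (hS : IsCSClosed S) :
    interior (closure S) ⊆ S := by
  intro x hx
  obtain ⟨ε, hε, hball⟩ := Metric.isOpen_iff.1 isOpen_interior x hx
  have h : closedBall x (ε / 2) ⊆ closure S :=
    (closedBall_subset_ball (by linarith)).trans (hball.trans interior_subset)
  exact hS.closedBall_subset (by positivity) h (mem_closedBall_self (by positivity))

/-- **Theorem 4.1.7** (Open Mapping Theorem for cs-closed sets; Borwein–Zhu 2005, p. 114).  If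
`S` is a cs-closed subset of a normed space then `int S = int S̄`: cs-closed sets share their
interior points with their closure.
[cite: BorweinZhu2005, §4.1.3, Thm 4.1.7, p. 114] -/
theorem IsCSClosed.interior_eq_interior_closure {S : Set X} (hS : IsCSClosed S) :
    interior S = interior (closure S) :=
  Subset.antisymm (interior_mono subset_closure)
    (interior_maximal hS.interior_closure_subset isOpen_interior)

/-! ## Core versus interior -/

/-- The **core** of a set (Borwein–Zhu 2005, p. 114): `s ∈ core S` provided
`⋃_{λ>0} λ(S − s) = X`, i.e. every direction `y` admits `t > 0` with `s + t y ∈ S`.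
[cite: BorweinZhu2005, §4.1.3, definition of core, p. 114] -/
def algCore (S : Set X) : Set X := {s | ∀ y : X, ∃ t : ℝ, 0 < t ∧ s + t • y ∈ S}

/-- Membership in the core, unfolded.
[cite: BorweinZhu2005, §4.1.3, definition of core, p. 114] -/
theorem mem_algCore_iff {S : Set X} {s : X} :
    s ∈ algCore S ↔ ∀ y : X, ∃ t : ℝ, 0 < t ∧ s + t • y ∈ S := Iff.rfl

/-- The book's formula for the core: `s ∈ core S` iff `⋃_{λ>0} λ(S − s) = X`.
[cite: BorweinZhu2005, §4.1.3, definition of core, p. 114] -/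
theorem mem_algCore_iff_iUnion_eq_univ {S : Set X} {s : X} :
    s ∈ algCore S ↔ ⋃ (t : ℝ) (_ : 0 < t), t • ((fun z => z - s) '' S) = univ := by
  rw [Set.eq_univ_iff_forall, mem_algCore_iff]
  constructor
  · intro h y
    obtain ⟨t, ht, hmem⟩ := h y
    refine Set.mem_iUnion₂.2 ⟨t⁻¹, inv_pos.2 ht, Set.mem_smul_set.2 ⟨t • y, ?_, ?_⟩⟩
    · exact ⟨s + t • y, hmem, by simp⟩
    · rw [smul_smul, inv_mul_cancel₀ ht.ne', one_smul]
  · intro h y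
    obtain ⟨t, ht, hy⟩ := Set.mem_iUnion₂.1 (h y)
    obtain ⟨z, ⟨p, hp, rfl⟩, hz⟩ := Set.mem_smul_set.1 hy
    refine ⟨t⁻¹, inv_pos.2 ht, ?_⟩
    rw [← hz, smul_smul, inv_mul_cancel₀ ht.ne', one_smul, add_sub_cancel]
    exact hp

/-- A point of the core belongs to the set (direction `y = 0`).
[cite: BorweinZhu2005, §4.1.3, definition of core, p. 114] -/
theorem algCore_subset (S : Set X) : algCore S ⊆ S := by
  intro s hs
  obtain ⟨t, -, h⟩ := hs 0
  simpa using h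

/-- **Exercise 4.1.17** (Borwein–Zhu 2005, p. 114: "clearly, `int(S) ⊆ core(S)`").
[cite: BorweinZhu2005, §4.1.3, p. 114; Exercise 4.1.17] -/
theorem interior_subset_algCore (S : Set X) : interior S ⊆ algCore S := by
  intro s hs y
  obtain ⟨ε, hε, hball⟩ := Metric.isOpen_iff.1 isOpen_interior s hs
  refine ⟨ε / (2 * (‖y‖ + 1)), by positivity, interior_subset (hball ?_)⟩
  rw [mem_ball, dist_eq_norm, add_sub_cancel_left, norm_smul, Real.norm_of_nonneg (by positivity)]
  calc ε / (2 * (‖y‖ + 1)) * ‖y‖ ≤ ε / (2 * (‖y‖ + 1)) * (‖y‖ + 1) := by gcongr; linarith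
    _ = ε / 2 := by field_simp
    _ < ε := by linarith

/-- The neighbourhood step shared by the printed proofs of Theorems 4.1.3 and 4.1.8 ("the set
`U = {λz + (1 − λ)b : b ∈ B_r(x)}` is a neighborhood of `x̄`"): a core point of a convex set with
nonempty interior is an interior point.
[cite: BorweinZhu2005, §4.1.3, proof of Thm 4.1.8, pp. 114–115] -/
theorem mem_interior_of_mem_algCore {S : Set X} (hS : Convex ℝ S) (hne : (interior S).Nonempty)
    {s : X} (hs : s ∈ algCore S) : s ∈ interior S := by
  obtain ⟨x₀, hx₀⟩ := hne
  obtain ⟨t, ht, hz⟩ := hs (s - x₀)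
  set a : ℝ := t / (1 + t) with ha
  have ha0 : 0 < a := by positivity
  have h1 : (1 - a) * (1 + t) = 1 := by rw [ha]; field_simp; ring
  have h2 : a - (1 - a) * t = 0 := by rw [ha]; field_simp; ring
  have key : a • x₀ + (1 - a) • (s + t • (s - x₀)) = s := by
    calc a • x₀ + (1 - a) • (s + t • (s - x₀))
        = (a - (1 - a) * t) • x₀ + ((1 - a) * (1 + t)) • s := by module
      _ = s := by rw [h1, h2, zero_smul, one_smul, zero_add]
  rw [← key]
  have ha1 : 0 ≤ 1 - a := by
    have : (1 - a) * (1 + t) = 1 := h1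
    nlinarith
  exact hS.combo_interior_self_mem_interior hx₀ hz ha0 ha1 (by ring)

/-- For a convex set, a core point `s` and a direction `y`, the points `s + (n+1)⁻¹ y` lie in
the set for all large `n`. [folklore] -/
private theorem eventually_add_inv_smul_mem {S : Set X} (hS : Convex ℝ S) {s : X}
    (hs : s ∈ algCore S) (y : X) : ∃ N : ℕ, ∀ n, N ≤ n → s + ((n : ℝ) + 1)⁻¹ • y ∈ S := by
  obtain ⟨t, ht, hmem⟩ := hs y
  obtain ⟨N, hN⟩ := exists_nat_gt (1 / t)
  refine ⟨N, fun n hn => ?_⟩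
  have hsS : s ∈ S := algCore_subset S hs
  have hn1 : (0 : ℝ) < (n : ℝ) + 1 := by positivity
  have hle : ((n : ℝ) + 1)⁻¹ ≤ t := by
    rw [inv_le_comm₀ hn1 ht]
    have : (N : ℝ) ≤ n := by exact_mod_cast hn
    rw [one_div] at hN
    linarith
  -- `s + (n+1)⁻¹ y` is on the segment from `s` to `s + t y`
  set c : ℝ := ((n : ℝ) + 1)⁻¹ / t with hc
  have hc0 : 0 ≤ c := by positivity
  have hc1 : c ≤ 1 := by rw [hc, div_le_one ht]; exact hle
  have e : s + ((n : ℝ) + 1)⁻¹ • y = (1 - c) • s + c • (s + t • y) := by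
    have : c * t = ((n : ℝ) + 1)⁻¹ := by rw [hc]; field_simp
    rw [smul_add, smul_smul, this]
    module
  rw [e]
  exact hS hsS hmem (by linarith) hc0 (by ring)

/-- **Exercise 4.1.7** (Borwein–Zhu 2005): for a cs-closed subset `C` of a Banach space,
`int C = core C`.  (Proof: `C` is convex; for `s ∈ core C` the closed sets
`{y | s + (n+1)⁻¹y ∈ C̄}` cover `X`, so by Baire `int C̄ ≠ ∅`, hence `int C ≠ ∅` by Theorem 4.1.7,
and a core point of a convex set with nonempty interior is interior.)
[cite: BorweinZhu2005, §4.1.4, Exercise 4.1.7] -/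
theorem IsCSClosed.interior_eq_algCore [CompleteSpace X] {C : Set X} (hC : IsCSClosed C) :
    interior C = algCore C := by
  refine Subset.antisymm (interior_subset_algCore C) fun s hs => ?_
  have hCv : Convex ℝ C := hC.convex
  set F : ℕ → Set X := fun n => {y | s + ((n : ℝ) + 1)⁻¹ • y ∈ closure C} with hF
  have hFc : ∀ n, IsClosed (F n) := fun n =>
    isClosed_closure.preimage (continuous_const.add (continuous_const.smul continuous_id))
  have hFU : ⋃ n, F n = univ := by
    refine eq_univ_of_forall fun y => ?_
    obtain ⟨N, hN⟩ := eventually_add_inv_smul_mem hCv hs y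
    exact mem_iUnion.2 ⟨N, subset_closure (hN N le_rfl)⟩
  haveI : Nonempty X := ⟨s⟩
  obtain ⟨n, p, hp⟩ := nonempty_interior_of_iUnion_of_closed hFc hFU
  obtain ⟨ε, hε, hball⟩ := Metric.isOpen_iff.1 isOpen_interior p hp
  -- the ball of radius `(n+1)⁻¹ ε` around `s + (n+1)⁻¹ p` lies in `C̄`
  have hn1 : (0 : ℝ) < (n : ℝ) + 1 := by positivity
  have hsub : ball (s + ((n : ℝ) + 1)⁻¹ • p) (((n : ℝ) + 1)⁻¹ * ε) ⊆ closure C := by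
    intro q hq
    have hy : ((n : ℝ) + 1) • (q - s) ∈ F n := by
      refine interior_subset (hball ?_)
      rw [mem_ball, dist_eq_norm] at hq ⊢
      have e : ((n : ℝ) + 1) • (q - s) - p = ((n : ℝ) + 1) • (q - (s + ((n : ℝ) + 1)⁻¹ • p)) := by
        rw [smul_sub, smul_sub, smul_add, smul_smul, mul_inv_cancel₀ hn1.ne', one_smul]
        abel
      rw [e, norm_smul, Real.norm_of_nonneg hn1.le]
      calc ((n : ℝ) + 1) * ‖q - (s + ((n : ℝ) + 1)⁻¹ • p)‖ < ((n : ℝ) + 1) * (((n : ℝ) + 1)⁻¹ * ε) := by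
            gcongr
        _ = ε := by field_simp
    have : s + ((n : ℝ) + 1)⁻¹ • (((n : ℝ) + 1) • (q - s)) ∈ closure C := hy
    rwa [smul_smul, inv_mul_cancel₀ hn1.ne', one_smul, add_sub_cancel] at this
  have hne : (interior C).Nonempty := by
    rw [hC.interior_eq_interior_closure]
    exact ⟨_, interior_mono hsub (by
      rw [isOpen_ball.interior_eq]; exact mem_ball_self (by positivity))⟩
  exact mem_interior_of_mem_algCore hCv hne hs

/-- **Theorem 4.1.8** (Borwein–Zhu 2005, pp. 114–115).  Let `X` be a Banach space and
`f : X → ℝ ∪ {+∞}` a lsc convex function with domain `D` (sublevel sets `{x ∈ D | f x ≤ a}`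
closed).  Then `core (dom f) = int (dom f)`.  Printed proof: for `x̄ ∈ core D` the closed sets
`j(Dᵢ − x̄)` cover `X` (4.1.5), so by the Baire category theorem some `Dᵢ` has an interior
point, and convexity then makes `x̄` an interior point of `D`.
[cite: BorweinZhu2005, §4.1.3, Thm 4.1.8, pp. 114–115] -/
theorem algCore_eq_interior_of_lsc [CompleteSpace X] {D : Set X} {f : X → ℝ}
    (hf : ConvexOn ℝ D f) (hlsc : ∀ a : ℝ, IsClosed {x | x ∈ D ∧ f x ≤ a}) :
    algCore D = interior D := by
  refine Subset.antisymm (fun z hz => ?_) (interior_subset_algCore D)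
  have hDv : Convex ℝ D := hf.1
  set F : ℕ × ℕ → Set X := fun p =>
    {y | z + ((p.1 : ℝ) + 1)⁻¹ • y ∈ {x | x ∈ D ∧ f x ≤ p.2}} with hF
  have hFc : ∀ p, IsClosed (F p) := fun p =>
    (hlsc p.2).preimage (continuous_const.add (continuous_const.smul continuous_id))
  have hFU : ⋃ p, F p = univ := by
    refine eq_univ_of_forall fun y => ?_
    obtain ⟨N, hN⟩ := eventually_add_inv_smul_mem hDv hz y
    obtain ⟨i, hi⟩ := exists_nat_ge (f (z + ((N : ℝ) + 1)⁻¹ • y))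
    exact mem_iUnion.2 ⟨(N, i), ⟨hN N le_rfl, hi⟩⟩
  haveI : Nonempty X := ⟨z⟩
  obtain ⟨⟨n, i⟩, p, hp⟩ := nonempty_interior_of_iUnion_of_closed hFc hFU
  obtain ⟨ε, hε, hball⟩ := Metric.isOpen_iff.1 isOpen_interior p hp
  have hn1 : (0 : ℝ) < (n : ℝ) + 1 := by positivity
  have hsub : ball (z + ((n : ℝ) + 1)⁻¹ • p) (((n : ℝ) + 1)⁻¹ * ε) ⊆ D := by
    intro q hq
    have hy : ((n : ℝ) + 1) • (q - z) ∈ F (n, i) := by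
      refine interior_subset (hball ?_)
      rw [mem_ball, dist_eq_norm] at hq ⊢
      have e : ((n : ℝ) + 1) • (q - z) - p
          = ((n : ℝ) + 1) • (q - (z + ((n : ℝ) + 1)⁻¹ • p)) := by
        rw [smul_sub, smul_sub, smul_add, smul_smul, mul_inv_cancel₀ hn1.ne', one_smul]
        abel
      rw [e, norm_smul, Real.norm_of_nonneg hn1.le]
      calc ((n : ℝ) + 1) * ‖q - (z + ((n : ℝ) + 1)⁻¹ • p)‖
          < ((n : ℝ) + 1) * (((n : ℝ) + 1)⁻¹ * ε) := by gcongr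
        _ = ε := by field_simp
    have : z + ((n : ℝ) + 1)⁻¹ • (((n : ℝ) + 1) • (q - z)) ∈ {x | x ∈ D ∧ f x ≤ i} := hy
    rw [smul_smul, inv_mul_cancel₀ hn1.ne', one_smul, add_sub_cancel] at this
    exact this.1
  have hne : (interior D).Nonempty :=
    ⟨_, interior_mono hsub (by
      rw [isOpen_ball.interior_eq]; exact mem_ball_self (by positivity))⟩
  exact mem_interior_of_mem_algCore hDv hne hz

/-! ## Exercise 4.1.18: core versus interior in `ℝ²` -/

/-- The set of **Exercise 4.1.18** (Borwein–Zhu 2005): `S = {(x, y) | y = 0 or |y| ≥ x²} ⊆ ℝ²`.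
[cite: BorweinZhu2005, §4.1.4, Exercise 4.1.18] -/
def coreVsInteriorSet : Set (ℝ × ℝ) := {p | p.2 = 0 ∨ p.1 ^ 2 ≤ |p.2|}

/-- **Exercise 4.1.18**, first half: `0 ∈ core S`.
[cite: BorweinZhu2005, §4.1.4, Exercise 4.1.18] -/
theorem zero_mem_algCore_coreVsInteriorSet : (0 : ℝ × ℝ) ∈ algCore coreVsInteriorSet := by
  intro y
  obtain ⟨a, b⟩ := y
  by_cases hb : b = 0
  · refine ⟨1, one_pos, Or.inl ?_⟩
    simp [hb]
  · have hb' : 0 < |b| := abs_pos.2 hb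
    refine ⟨|b| / (a ^ 2 + |b|), by positivity, Or.inr ?_⟩
    simp only [Prod.smul_mk, smul_eq_mul, zero_add]
    rw [abs_mul, abs_of_pos (by positivity : (0 : ℝ) < |b| / (a ^ 2 + |b|)), mul_pow]
    -- `(|b|/(a²+|b|))² a² ≤ (|b|/(a²+|b|)) |b|` iff `(|b|/(a²+|b|)) a² ≤ |b|`
    have hab : 0 < a ^ 2 + |b| := by positivity
    rw [show (|b| / (a ^ 2 + |b|)) ^ 2 * a ^ 2 = |b| / (a ^ 2 + |b|) * (|b| / (a ^ 2 + |b|) * a ^ 2)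
      by ring]
    gcongr
    rw [div_mul_eq_mul_div, div_le_iff₀ hab]
    nlinarith [sq_nonneg a, abs_nonneg b]

/-- **Exercise 4.1.18**, second half: `0 ∉ int S` (the points `(δ, δ²/2)` avoid `S`), so
`0 ∈ core(S) \ int(S)` and the inclusion of Exercise 4.1.17 can be proper.
[cite: BorweinZhu2005, §4.1.4, Exercise 4.1.18] -/
theorem zero_notMem_interior_coreVsInteriorSet : (0 : ℝ × ℝ) ∉ interior coreVsInteriorSet := by
  intro h
  obtain ⟨ε, hε, hball⟩ := Metric.isOpen_iff.1 isOpen_interior 0 h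
  set δ : ℝ := min (ε / 2) 1 with hδ
  have hδ0 : 0 < δ := by positivity
  have hδε : δ < ε := (min_le_left _ _).trans_lt (by linarith)
  have hδ1 : δ ≤ 1 := min_le_right _ _
  have hmem : ((δ, δ ^ 2 / 2) : ℝ × ℝ) ∈ coreVsInteriorSet := by
    refine interior_subset (hball ?_)
    rw [mem_ball, dist_zero_right, Prod.norm_mk, Real.norm_of_nonneg hδ0.le,
      Real.norm_of_nonneg (by positivity)]
    refine max_lt hδε (lt_of_le_of_lt ?_ hδε)
    nlinarith
  rcases hmem with h0 | hle
  · simp only at h0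
    have : 0 < δ ^ 2 / 2 := by positivity
    linarith
  · simp only at hle
    rw [abs_of_nonneg (by positivity)] at hle
    nlinarith

/-- Summary of **Exercise 4.1.18** (Core Versus Interior): `0 ∈ core(S) \ int(S)`.
[cite: BorweinZhu2005, §4.1.4, Exercise 4.1.18] -/
theorem zero_mem_algCore_diff_interior :
    (0 : ℝ × ℝ) ∈ algCore coreVsInteriorSet \ interior coreVsInteriorSet :=
  ⟨zero_mem_algCore_coreVsInteriorSet, zero_notMem_interior_coreVsInteriorSet⟩

end Literature.Analysis.Convex.ConvexSeriesClosed
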